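import Mathlib
import HarnessLib
import Literature.Geometry.Lorentzian.KerrConvergence
import Literature.Geometry.Lorentzian.KerrSchild
import Summits.FinalStateConjecture.FinalStateConjecture.Theorems.StarvedNecksFutureOrientedOfSeamedStubRay
import Literature.Uncategorized.BandAnchoredPaths

/-!
# S3a — anchored paths in the band of a boosted Kerr background

For a boosted Kerr background `B = boostedKerrBackground Λ c M a` with orthochronous `Λ`
(`(Λ e₀)⁰ > 0`) and a monotone lab-time wall `W`, every point `x` of the band
`{τ₁ ≤ t, R₁+½ ≤ r ≤ W(x⁰)}` (`R₁+½ > max r₊ 0`) lies on a preconnected coordinate set inside the band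
that meets the anchor sphere `{r = R₁+½}`.

Main declarations: `BandAnchoredPaths` (the statement registered as stub S3a of the `NeckGapDecay`
skeleton, verbatim) and `stub_bandAnchoredPaths : Literature.Uncategorized.BandAnchoredPaths`.

Proof: with `x = Λ(τ, ξ) + c` (rest-frame time `τ`, spatial part `ξ`), the path
`σ ↦ Λ(τ + (1 − σ) s₀, σ ξ) + c`, `σ ∈ [σ⋆, 1]`, goes forward in rest-frame time while moving inward
along the rest-frame spatial ray; its rest-frame radius `r(τ', σ ξ)` does not depend on `τ'`, is
monotone in `σ ≥ 0` (`radius_ray_monotone`) and vanishes at `σ = 0`, so the intermediate value theorem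
gives `σ⋆ ∈ [0, 1]` with radius exactly `R₁+½`, and the radius stays in `[R₁+½, r(x)]` on `[σ⋆, 1]`.
Its lab time is `x⁰ + (1 − σ)(s₀ (Λe₀)⁰ − ℓ)` with `ℓ = (Λ(0, ξ))⁰`; the choice `s₀ = |ℓ| / (Λe₀)⁰`
makes it `≥ x⁰`, so the monotone wall is respected: `r ≤ r(x) ≤ W(x⁰) ≤ W(lab time)`.
-/

noncomputable section

open scoped Manifold ContDiff Topology ENNReal
open Filter Set MeasureTheory Topology Literature.Geometry.Lorentzian

namespace Summit.FinalStateConjecture.FinalStateConjecture.Theorems.NeckGapDecay.ConnectionLevelCones.BandAnchoredPathsStub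
set_option linter.dupNamespace false

/-- Time–space splitting of `(t, y)`: `(t, y) = t e₀ + (0, y)`. [folklore] -/
private theorem ofTimeSpace_eq_smul_add (t : ℝ) (y : E3) :
    E4.ofTimeSpace t y = t • E4.basisVector 0 + E4.ofTimeSpace 0 y := by
  ext i
  refine Fin.cases ?_ (fun j => ?_) i
  · simp
  · simp [Fin.succ_ne_zero]

/-- `(0, σ y) = σ (0, y)`. [folklore] -/
private theorem ofTimeSpace_zero_smul (σ : ℝ) (y : E3) :
    E4.ofTimeSpace 0 (σ • y) = σ • E4.ofTimeSpace 0 y := by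
  ext i
  refine Fin.cases ?_ (fun j => ?_) i
  · simp
  · simp

/-- The Kerr–Schild radius of `(t, y)` does not depend on the time `t`. [folklore] -/
private theorem radius_ofTimeSpace_time (a t t' : ℝ) (y : E3) :
    Kerr.radius a (E4.ofTimeSpace t y) = Kerr.radius a (E4.ofTimeSpace t' y) := by
  have h3 : E4.ofTimeSpace t y 3 = y 2 := by
    have h := E4.ofTimeSpace_apply_succ t y 2
    simpa using h
  have h3' : E4.ofTimeSpace t' y 3 = y 2 := by
    have h := E4.ofTimeSpace_apply_succ t' y 2
    simpa using h
  unfold Kerr.radius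
  rw [E4.spatialNorm_ofTimeSpace, E4.spatialNorm_ofTimeSpace, h3, h3']

/-- **Stub S3a** (`stub_bandAnchoredPaths`): every band point is joined inside the band to the anchor sphere
`{r = R₁+½}` by the boosted image of the rest-frame path `σ ↦ (τ + (1 − σ) s₀, σ ξ)`, `σ ∈ [σ⋆, 1]`
(forward in time, inward along the spatial ray; `σ⋆` from the intermediate value theorem, `s₀` chosen so
that lab time does not decrease). [folklore] -/
theorem stub_bandAnchoredPaths : Literature.Uncategorized.BandAnchoredPaths := by
  intro Λ c M a W R₁ τ₁ hv hW hR B x hxt hxr hxW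
  -- notation
  set L : E4 ≃L[ℝ] E4 := (Λ : E4 ≃L[ℝ] E4) with hLdef
  set e₀ : E4 := E4.basisVector 0 with he₀
  set v0 : ℝ := L e₀ 0 with hv0def
  have hv0 : 0 < v0 := hv
  set x' : E4 := poincareInv Λ c x.1 with hx'def
  set τ : ℝ := x' 0 with hτdef
  set ξ : E3 := E4.spatial x' with hξdef
  have hx' : x' = E4.ofTimeSpace τ ξ := (E4.ofTimeSpace_time_spatial x').symm
  set ζ : E4 := E4.ofTimeSpace 0 ξ with hζdef
  set ℓ : ℝ := L ζ 0 with hℓdef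
  set s₀ : ℝ := |ℓ| / v0 with hs₀def
  have hs₀ : 0 ≤ s₀ := div_nonneg (abs_nonneg _) hv0.le
  have hs₀v : s₀ * v0 = |ℓ| := div_mul_cancel₀ _ hv0.ne'
  -- hypotheses on `x`, unfolded
  have hxt' : τ₁ ≤ τ := hxt
  have hxr' : R₁ + 1 / 2 ≤ Kerr.radius a x' := hxr
  have hxW' : Kerr.radius a x' ≤ W (x.1 0) := hxW
  -- the rest-frame path, its boosted image, and the radius along the ray
  let p : ℝ → E4 := fun σ ↦ (τ + (1 - σ) * s₀) • e₀ + σ • ζ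
  let γ : ℝ → E4 := fun σ ↦ L (p σ) + c
  let f : ℝ → ℝ := fun σ ↦ Kerr.radius a (E4.ofTimeSpace τ (σ • ξ))
  have hp : ∀ σ, p σ = E4.ofTimeSpace (τ + (1 - σ) * s₀) (σ • ξ) := by
    intro σ
    rw [ofTimeSpace_eq_smul_add, ofTimeSpace_zero_smul]
  have hγinv : ∀ σ, poincareInv Λ c (γ σ) = p σ := by
    intro σ
    simp only [γ, poincareInv, add_sub_cancel_right, hLdef, ContinuousLinearEquiv.symm_apply_apply]
  have hp1 : p 1 = x' := by
    rw [hp, hx', sub_self, zero_mul, add_zero, one_smul]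
  have hγ1 : γ 1 = x.1 := by
    have h : L (poincareInv Λ c x.1) + c = x.1 := by
      simp only [poincareInv, hLdef, ContinuousLinearEquiv.apply_symm_apply, sub_add_cancel]
    show L (p 1) + c = x.1
    rw [hp1]
    exact h
  have hpc : Continuous p := by
    show Continuous fun σ : ℝ ↦ (τ + (1 - σ) * s₀) • e₀ + σ • ζ
    fun_prop
  have hγc : Continuous γ := (L.continuous.comp hpc).add continuous_const
  have hfc : Continuous f :=
    (Kerr.continuous_radius a).comp
      ((E4.continuous_ofTimeSpace τ).comp (continuous_id.smul continuous_const))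
  have hf0 : f 0 = 0 := by
    show Kerr.radius a (E4.ofTimeSpace τ ((0 : ℝ) • ξ)) = 0
    rw [zero_smul]
    exact Summit.FinalStateConjecture.FinalStateConjecture.Theorems.FutureOrientedOfSeamed.ClockDualityRays.radius_ofTimeSpace_zero_right
      a τ
  have hf1 : f 1 = Kerr.radius a x' := by
    show Kerr.radius a (E4.ofTimeSpace τ ((1 : ℝ) • ξ)) = _
    rw [one_smul, hx']
  -- time, radius and lab time along the path
  have htime : ∀ σ, poincareInv Λ c (γ σ) 0 = τ + (1 - σ) * s₀ := by
    intro σ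
    rw [hγinv, hp]
    exact E4.ofTimeSpace_apply_zero _ _
  have hrad : ∀ σ, Kerr.radius a (poincareInv Λ c (γ σ)) = f σ := by
    intro σ
    rw [hγinv, hp]
    exact radius_ofTimeSpace_time a _ τ _
  have hlab : ∀ σ, γ σ 0 = (τ + (1 - σ) * s₀) * v0 + σ * ℓ + c 0 := by
    intro σ
    show (L ((τ + (1 - σ) * s₀) • e₀ + σ • ζ) + c) 0 = _
    rw [map_add, map_smul, map_smul]
    rfl
  have hx0 : x.1 0 = τ * v0 + ℓ + c 0 := by
    have h := hlab 1
    rw [hγ1] at h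
    rw [h]
    ring
  have hlab_ge : ∀ σ, σ ≤ 1 → x.1 0 ≤ γ σ 0 := by
    intro σ hσ
    rw [hlab, hx0]
    have h1 : 0 ≤ 1 - σ := sub_nonneg.mpr hσ
    have h2 : ℓ ≤ |ℓ| := le_abs_self ℓ
    nlinarith [mul_nonneg h1 (sub_nonneg.mpr h2)]
  -- cut the ray at `r = R₁ + 1/2`
  have hRpos : 0 < R₁ + 1 / 2 := (le_max_right _ _).trans_lt hR
  obtain ⟨σ₀, hσ₀, hfσ₀⟩ : ∃ σ₀ ∈ Icc (0 : ℝ) 1, f σ₀ = R₁ + 1 / 2 :=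
    intermediate_value_Icc zero_le_one hfc.continuousOn
      ⟨by rw [hf0]; exact hRpos.le, by rw [hf1]; exact hxr'⟩
  have hseg : ∀ σ ∈ Icc σ₀ 1, R₁ + 1 / 2 ≤ f σ ∧ f σ ≤ Kerr.radius a x' := by
    intro σ hσ
    have hlo : f σ₀ ≤ f σ :=
      Summit.FinalStateConjecture.FinalStateConjecture.Theorems.FutureOrientedOfSeamed.ClockDualityRays.radius_ray_monotone
        a τ ξ hσ₀.1 hσ.1
    have hhi : f σ ≤ f 1 :=
      Summit.FinalStateConjecture.FinalStateConjecture.Theorems.FutureOrientedOfSeamed.ClockDualityRays.radius_ray_monotone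
        a τ ξ (hσ₀.1.trans hσ.1) hσ.2
    rw [hfσ₀] at hlo
    rw [hf1] at hhi
    exact ⟨hlo, hhi⟩
  refine ⟨γ '' Icc σ₀ 1, isPreconnected_Icc.image γ hγc.continuousOn, ?_, ⟨1, right_mem_Icc.mpr hσ₀.2, hγ1⟩,
    ?_, ⟨γ σ₀, ⟨σ₀, left_mem_Icc.mpr hσ₀.2, rfl⟩, ?_⟩⟩
  · rintro _ ⟨σ, hσ, rfl⟩
    show poincareInv Λ c (γ σ) ∈ Kerr.exterior M a
    rw [Kerr.mem_exterior, hrad]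
    exact hR.trans_le (hseg σ hσ).1
  · rintro _ ⟨σ, hσ, rfl⟩
    refine ⟨?_, ?_, ?_⟩
    · show τ₁ ≤ poincareInv Λ c (γ σ) 0
      rw [htime]
      have : 0 ≤ (1 - σ) * s₀ := mul_nonneg (sub_nonneg.mpr hσ.2) hs₀
      linarith
    · show R₁ + 1 / 2 ≤ Kerr.radius a (poincareInv Λ c (γ σ))
      rw [hrad]
      exact (hseg σ hσ).1
    · show Kerr.radius a (poincareInv Λ c (γ σ)) ≤ W (γ σ 0)
      rw [hrad]
      exact ((hseg σ hσ).2.trans hxW').trans (hW (hlab_ge σ hσ.2))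
  · show Kerr.radius a (poincareInv Λ c (γ σ₀)) = R₁ + 1 / 2
    rw [hrad]
    exact hfσ₀

end Summit.FinalStateConjecture.FinalStateConjecture.Theorems.NeckGapDecay.ConnectionLevelCones.BandAnchoredPathsStub

end
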